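import Summits.BirchSwinnertonDyer.BirchSwinnertonDyer.Theorems.ThetaPartnerAtTwoSignedTransportAtTwoResidualKummer
import Literature.NumberTheory.EllipticCurves.TwoVariableAnticyclotomicControl
import HarnessLib

/-!
# `H¹(G_{ℚ_n}, W[2]) ↪ H¹(G_{ℚ_∞}, W[2])` on the habitat (`W[2]^{G_{ℚ_∞}} = 0`): the residual classes of every layer ASCEND injectively
# to the residual object of (R≥)ᵖ — First lemma `ResidualLayerAscends` of crux idea card `finite-layer-kummer-pairing-corank` (kernel)

Route `ResidualThetaTransportAtTwo` (RTT), crux (R≥)ᵖ `ResidualThetaCountLowerPureAtTwo` (stmt-BirchSwinnertonDyer-26074); seat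
`prover-bsd-wall-rtt-p2` g9 (`--supports`, closes nothing); card `Cruxes/ResidualThetaCountLowerPureAtTwo/Ideas/finite-layer-kummer-pairing-corank.md`
(ideator #1), whose lever is «one finite layer ℚ_n suffices»: a lower bound for the layer-`n` residual plus-Selmer group gives (R≥)ᵖ once
the layer classes inject into `H¹(G_{ℚ_∞}, W[2])` — this file is that injection, for EVERY `ℤ₂`-extension `κ` (the card's
`κ.IsCyclotomic` is not needed) and every habitat curve (`GoodSS W 2` only). HONEST FRAMING: THEOREMS ONLY; nothing about local
conditions or counts; BSD is not proved by any of this.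

WHAT (`W/ℚ` globally minimal with `GoodSS W 2`; `κ` any `ℤ₂`-extension of `ℚ`; `W[2] = (W.geomPrimaryTorsion 2)[2]` with its `Γ_ℚ`-action):
* `eq_zero_of_forall_kerSubgroup_smul_eq` — `W[2]^{G_{ℚ_∞}} = 0` (from the tree's `SignedTransportAtTwo.fixedPoints_kerSubgroup_eq_bot_of_goodSS`:
  `W(ℚ_∞)[2^∞] = 0`);
* **`resOfLe_torsionBy_injective`** — for every subgroup `H ⊇ G_{ℚ_∞}` (e.g. `G_{ℚ_n} = κ.layerSubgroup n`, or `Γ_ℚ`), the restriction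
  `H¹(H, W[2]) → H¹(G_{ℚ_∞}, W[2])` is injective (inflation–restriction with trivial invariants; tree tool
  `resOfLe_injective_of_forall_fixed_eq_zero`, Greenberg LNM 1716 Lemma 3.1 shape);
* **`residualLayerAscends`** — the card's statement verbatim (`κ.IsCyclotomic →` kept as an idle binder).

References: [GreenbergLNM1716] §3 Lemma 3.1; [GreenbergVatsal2000] §2 (residual Selmer groups over `ℚ_∞`); [SerreLocalFields1979] VII §6.
-/

set_option autoImplicit false
-- the Theorems namespace of this sub repeats the summit name by design (D-0017 nested layout)
set_option linter.dupNamespace false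

noncomputable section

open scoped Classical AddSubgroup
open WeierstrassCurve Literature.NumberTheory.EllipticCurves Literature.NumberTheory.EllipticCurves.Rank1Residual Field

namespace Summit.BirchSwinnertonDyer.BirchSwinnertonDyer.Theorems.ResidualLayer

variable (W : WeierstrassCurve ℚ) [W.IsElliptic] [W.IsGloballyMinimal]

/-- **`W[2]^{G_{ℚ_∞}} = 0` on the habitat**: a `2`-torsion point fixed by `Gal(ℚ̄/ℚ_∞)` is zero (`W(ℚ_∞)[2^∞] = 0`, tree
`SignedTransportAtTwo.fixedPoints_kerSubgroup_eq_bot_of_goodSS`). [cite: GreenbergLNM1716, §4 p. 109] -/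
theorem eq_zero_of_forall_kerSubgroup_smul_eq (hss : GoodSS W 2) (κ : ZpExtension ℚ 2)
    (m : ↥((↥(W.geomPrimaryTorsion 2))[(2 : ℤ)])) (hm : ∀ x ∈ κ.kerSubgroup, x • m = m) : m = 0 := by
  have hbot := SignedTransportAtTwo.fixedPoints_kerSubgroup_eq_bot_of_goodSS W hss κ
  have hmem : (m : ↥(W.geomPrimaryTorsion 2)) ∈ FixedPoints.addSubgroup κ.kerSubgroup (↥(W.geomPrimaryTorsion 2)) := by
    rw [FixedPoints.mem_addSubgroup]
    intro g
    change (g : absoluteGaloisGroup ℚ) • (m : ↥(W.geomPrimaryTorsion 2)) = m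
    rw [← AddSubgroup.torsionBy.coe_smul, hm g g.2]
  rw [hbot, AddSubgroup.mem_bot] at hmem
  exact Subtype.ext hmem

/-- **Inflation–restriction with trivial invariants**: for every subgroup `H` of `Γ_ℚ` containing `G_{ℚ_∞} = κ.kerSubgroup`, the
restriction `H¹(H, W[2]) → H¹(G_{ℚ_∞}, W[2])` is injective on the habitat. [cite: GreenbergLNM1716, §3 Lemma 3.1] -/
theorem resOfLe_torsionBy_injective (hss : GoodSS W 2) (κ : ZpExtension ℚ 2) {H : Subgroup (absoluteGaloisGroup ℚ)}
    (hle : κ.kerSubgroup ≤ H) :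
    Function.Injective (resOfLe (↥((↥(W.geomPrimaryTorsion 2))[(2 : ℤ)])) hle) :=
  resOfLe_injective_of_forall_fixed_eq_zero hle (fun m hm ↦ eq_zero_of_forall_kerSubgroup_smul_eq W hss κ m hm)

/-- **`ResidualLayerAscends`** (crux idea card `finite-layer-kummer-pairing-corank`, First lemma, verbatim shape): on the habitat, for the
cyclotomic (indeed any) `ℤ₂`-extension and every layer `n`, `res : H¹(G_{ℚ_n}, W[2]) → H¹(G_{ℚ_∞}, W[2])` is injective.
[cite: GreenbergLNM1716, §3 Lemma 3.1] -/
theorem residualLayerAscends :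
    ∀ (W : WeierstrassCurve ℚ) [W.IsElliptic] [W.IsGloballyMinimal], GoodSS W 2 → ∀ (κ : ZpExtension ℚ 2), κ.IsCyclotomic →
      ∀ n : ℕ, Function.Injective (resOfLe (↥((↥(W.geomPrimaryTorsion 2))[(2 : ℤ)])) (κ.kerSubgroup_le_layerSubgroup n)) :=
  fun W _ _ hss κ _ n ↦ resOfLe_torsionBy_injective W hss κ (κ.kerSubgroup_le_layerSubgroup n)

end Summit.BirchSwinnertonDyer.BirchSwinnertonDyer.Theorems.ResidualLayer

end
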